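import Summits.KontsevichZagierPeriods.Zeta5Search.TwoTaleOmega.FormalBarnesUnique

/-!
# Formal Barnes functionals VII — operations on partial-fraction data (cell `pub-zeta5`, fam-tele gen 4)

HONEST FRAMING: systematic search; no irrationality claim unless certified.

OUR infrastructure (Summit side; finite algebra only), blueprint `families/tele/RECURRENCE.md §13.6 (F6/F7)`.  To turn a
certificate `Cert(t) = x(t)·Π(t+c_i)/Π(t+d_j)` (cert lanes, `certs/tele/bmiss_general/certificates.json`) into the DATA
of `G = Cert·R` one needs exactly two primitive operations on `PF` besides `add/smul`:
* `PF.mulLin c v` — data of `(t+c)·v(t)`:  `(t+c)·α/(t+k) = α + α(c−k)/(t+k)`, `(t+c)·β/(t+k)² = β/(t+k) + β(c−k)/(t+k)²`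
  (`PF.eval_mulLin`); multiplication by `t` is `mulLin 0`, so `x(t)·v` is Horner in `mulLin 0`, `add`, `smul`;
* `PF.divLin c v` — data of `v(t)/(t+c)` when `v` has no double pole at `−c` (a triple pole never occurs for the Ω
  certificates: `g4/kfun/pole_order2.log`):  polynomial part `(Q − Q(−c))/(X+c)`, `α_k/((t+k)(t+c)) = α_k/(c−k)·(1/(t+k) − 1/(t+c))`
  (`k ≠ c`), `α_c/(t+c)²`, `β_k/((t+k)²(t+c)) = β_k/(c−k)/(t+k)² − β_k/(c−k)²/(t+k) + β_k/(c−k)²/(t+c)` (`PF.eval_divLin`).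
With `PF.eq_of_eval_eq` (Lemma U) the results are independent of the order of operations.
-/

noncomputable section

open Polynomial Finset

namespace Summit.KontsevichZagierPeriods.Zeta5Search.FormalBarnes

namespace PF

/-! ### Multiplication by a linear factor -/

/-- The joint pole set of the data. -/
def poles (v : PF) : Finset ℤ := v.simple.support ∪ v.double.support

/-- The simple poles lie in the pole set. -/
theorem simple_support_subset_poles (v : PF) : v.simple.support ⊆ v.poles := subset_union_left
/-- The double poles lie in the pole set. -/
theorem double_support_subset_poles (v : PF) : v.double.support ⊆ v.poles := subset_union_right

/-- Data of `(t + c)·v(t)`. -/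
def mulLin (c : ℤ) (v : PF) : PF where
  poly := v.poly * (X + C (c : ℚ)) + C (v.simple.sum fun _ a => a)
  simple := Finsupp.onFinset v.poles (fun k => v.simple k * (c - k) + v.double k) (by
    intro k hk
    by_contra h
    rw [poles, mem_union, not_or, Finsupp.notMem_support_iff, Finsupp.notMem_support_iff] at h
    rw [h.1, h.2] at hk; simp at hk)
  double := Finsupp.onFinset v.double.support (fun k => v.double k * (c - k)) (by
    intro k hk
    by_contra h
    rw [Finsupp.notMem_support_iff] at h
    rw [h] at hk; simp at hk)

/-- **Evaluation of `mulLin`**: off the poles, `(v.mulLin c)(t) = (t + c)·v(t)`. -/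
theorem eval_mulLin (c : ℤ) (v : PF) (t : ℚ) (ht : ∀ k ∈ v.poles, t + k ≠ 0) :
    (v.mulLin c).eval t = (t + c) * v.eval t := by
  have hS1 := v.simple_support_subset_poles
  have hS2 := v.double_support_subset_poles
  simp only [PF.eval, mulLin]
  rw [Finsupp.onFinset_sum _ (fun _ => by simp), Finsupp.onFinset_sum _ (fun _ => by simp),
    Finsupp.sum_of_support_subset _ hS1 _ (fun _ _ => by simp),
    Finsupp.sum_of_support_subset _ hS1 _ (fun _ _ => by simp),
    Finsupp.sum_of_support_subset _ hS2 _ (fun _ _ => by simp),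
    sum_subset hS2 (fun k _ hk => by rw [Finsupp.notMem_support_iff.1 hk]; simp)]
  simp only [Polynomial.eval_add, Polynomial.eval_mul, Polynomial.eval_X, Polynomial.eval_C]
  have h1 : ∀ k ∈ v.poles, (v.simple k * (c - k) + v.double k) / (t + k)
      = (t + c) * (v.simple k / (t + k)) - v.simple k + v.double k / (t + k) := by
    intro k hk
    have := ht k hk
    field_simp
    ring
  have h2 : ∀ k ∈ v.poles, v.double k * (c - k) / (t + k) ^ 2
      = (t + c) * (v.double k / (t + k) ^ 2) - v.double k / (t + k) := by
    intro k hk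
    have := ht k hk
    field_simp
    ring
  rw [sum_congr rfl h1, sum_congr rfl h2, sum_sub_distrib, sum_add_distrib, sum_sub_distrib, ← mul_sum, ← mul_sum]
  ring

/-! ### Division by a linear factor -/

/-- A sum over indices `≠ c` ignores the `k = c` branch. -/
theorem sum_ite_ne_div {P : Finset ℤ} {c : ℤ} (hPc : ∀ k ∈ P, k ≠ c) (g h q : ℤ → ℚ) :
    ∑ k ∈ P, (if k = c then g k else h k) / q k = ∑ k ∈ P, h k / q k :=
  sum_congr rfl fun k hk => by rw [if_neg (hPc k hk)]

/-- Data of `v(t)/(t + c)`, valid when `v` has no double pole at `−c` (`v.double c = 0`). -/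
def divLin (c : ℤ) (v : PF) : PF where
  poly := (v.poly - C (v.poly.eval (-(c : ℚ)))) /ₘ (X + C (c : ℚ))
  simple := Finsupp.onFinset (insert c v.poles)
    (fun k => if k = c then
        v.poly.eval (-(c : ℚ)) - ∑ j ∈ v.poles.erase c, v.simple j / ((c : ℚ) - j)
          + ∑ j ∈ v.poles.erase c, v.double j / ((c : ℚ) - j) ^ 2
      else v.simple k / ((c : ℚ) - k) - v.double k / ((c : ℚ) - k) ^ 2) (by
    intro k hk
    by_cases hkc : k = c
    · exact mem_insert.2 (Or.inl hkc)
    · refine mem_insert_of_mem ?_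
      by_contra h
      rw [poles, mem_union, not_or, Finsupp.notMem_support_iff, Finsupp.notMem_support_iff] at h
      rw [if_neg hkc, h.1, h.2] at hk; simp at hk)
  double := Finsupp.onFinset (insert c v.poles)
    (fun k => if k = c then v.simple c else v.double k / ((c : ℚ) - k)) (by
    intro k hk
    by_cases hkc : k = c
    · exact mem_insert.2 (Or.inl hkc)
    · refine mem_insert_of_mem (v.double_support_subset_poles ?_)
      rw [if_neg hkc] at hk
      exact Finsupp.mem_support_iff.2 fun h => hk (by rw [h, zero_div]))

/-- Exact division: `((Q − Q(−c))/(X + c))·(X + c) = Q − Q(−c)`. -/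
theorem divByMonic_lin_mul (Q : ℚ[X]) (c : ℤ) :
    ((Q - C (Q.eval (-(c : ℚ)))) /ₘ (X + C (c : ℚ))) * (X + C (c : ℚ)) = Q - C (Q.eval (-(c : ℚ))) := by
  have hroot : IsRoot (Q - C (Q.eval (-(c : ℚ)))) (-(c : ℚ)) := by simp [IsRoot]
  have h := (mul_divByMonic_eq_iff_isRoot (p := Q - C (Q.eval (-(c : ℚ)))) (a := -(c : ℚ))).2 hroot
  rw [show (X - C (-(c : ℚ))) = X + C (c : ℚ) by simp] at h
  rw [mul_comm]; exact h

/-- **Evaluation of `divLin`**: off the poles and `−c`, and with no double pole at `−c`, `(v.divLin c)(t) =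
v(t)/(t + c)`. -/
theorem eval_divLin (c : ℤ) (v : PF) (hc : v.double c = 0) (t : ℚ) (htc : t + c ≠ 0)
    (ht : ∀ k ∈ v.poles, t + k ≠ 0) : (v.divLin c).eval t = v.eval t / (t + c) := by
  have hS1 : v.simple.support ⊆ insert c v.poles := v.simple_support_subset_poles.trans (subset_insert _ _)
  have hS2 : v.double.support ⊆ insert c v.poles := v.double_support_subset_poles.trans (subset_insert _ _)
  -- the polynomial part
  have hq : ((v.poly - C (v.poly.eval (-(c : ℚ)))) /ₘ (X + C (c : ℚ))).eval t
      = (v.poly.eval t - v.poly.eval (-(c : ℚ))) / (t + c) := by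
    rw [eq_div_iff htc]
    have h := congrArg (Polynomial.eval t) (divByMonic_lin_mul v.poly c)
    rwa [Polynomial.eval_mul, Polynomial.eval_add, Polynomial.eval_X, Polynomial.eval_C, Polynomial.eval_sub,
      Polynomial.eval_C] at h
  -- names for the pieces
  set P := v.poles.erase c with hP
  have hPc : ∀ k ∈ P, k ≠ c := fun k hk => (mem_erase.1 hk).1
  have hPt : ∀ k ∈ P, t + k ≠ 0 := fun k hk => ht k (mem_of_mem_erase hk)
  have hsplit : ∀ f : ℤ → ℚ, ∑ k ∈ insert c v.poles, f k = f c + ∑ k ∈ P, f k := by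
    intro f
    rw [← Finset.add_sum_erase _ f (mem_insert_self c v.poles), erase_insert_eq_erase]
  simp only [PF.eval, divLin]
  rw [hq, Finsupp.onFinset_sum _ (fun _ => by simp), Finsupp.onFinset_sum _ (fun _ => by simp),
    Finsupp.sum_of_support_subset _ hS1 _ (fun _ _ => by simp),
    Finsupp.sum_of_support_subset _ hS2 _ (fun _ _ => by simp),
    hsplit, hsplit, hsplit, hsplit]
  simp only [if_true, hc, zero_div]
  rw [sum_ite_ne_div hPc, sum_ite_ne_div hPc]
  -- termwise partial fractions on `P`
  have hterm : ∀ k ∈ P, (v.simple k / ((c : ℚ) - k) - v.double k / ((c : ℚ) - k) ^ 2) / (t + k)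
      + v.double k / ((c : ℚ) - k) / (t + k) ^ 2
      = (v.simple k / (t + k) + v.double k / (t + k) ^ 2 + v.simple k / ((c : ℚ) - k)
          - v.double k / ((c : ℚ) - k) ^ 2) / (t + c) := by
    intro k hk
    have h1 := hPt k hk
    have h2 : (c : ℚ) - k ≠ 0 := by
      rw [sub_ne_zero]; exact_mod_cast (hPc k hk).symm
    field_simp
    ring
  have hsum := sum_congr rfl hterm
  rw [sum_add_distrib, ← sum_div, sum_sub_distrib, sum_add_distrib, sum_add_distrib] at hsum
  -- assemble
  set Sa := ∑ k ∈ P, v.simple k / (t + k)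
  set Sb := ∑ k ∈ P, v.double k / (t + k) ^ 2
  set Sac := ∑ k ∈ P, v.simple k / ((c : ℚ) - k)
  set Sbc := ∑ k ∈ P, v.double k / ((c : ℚ) - k) ^ 2
  have e : ∑ k ∈ P, (v.simple k / ((c : ℚ) - k) - v.double k / ((c : ℚ) - k) ^ 2) / (t + k)
      = (Sa + Sb + Sac - Sbc) / (t + c) - ∑ k ∈ P, v.double k / ((c : ℚ) - k) / (t + k) ^ 2 := by
    rw [← hsum]; ring
  rw [e]
  field_simp
  ring


/-! ### Pole-set bookkeeping (to discharge the `t + k ≠ 0` side conditions when operations are chained) -/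

/-- `mulLin` creates no new poles. -/
theorem poles_mulLin_subset (c : ℤ) (v : PF) : (v.mulLin c).poles ⊆ v.poles := by
  intro k hk
  simp only [poles, mulLin, mem_union] at hk
  rcases hk with h | h
  · exact Finsupp.support_onFinset_subset h
  · exact v.double_support_subset_poles (Finsupp.support_onFinset_subset h)

/-- `divLin c` creates at most the pole `−c`. -/
theorem poles_divLin_subset (c : ℤ) (v : PF) : (v.divLin c).poles ⊆ insert c v.poles := by
  intro k hk
  simp only [poles, divLin, mem_union] at hk
  rcases hk with h | h
  · exact Finsupp.support_onFinset_subset h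
  · exact Finsupp.support_onFinset_subset h

/-- The poles of a sum lie in the union of the pole sets. -/
theorem poles_add_subset (v w : PF) : (v.add w).poles ⊆ v.poles ∪ w.poles := by
  intro k hk
  unfold poles PF.add at *
  simp only [mem_union] at hk ⊢
  rcases hk with h | h
  · have := Finsupp.support_add h
    rw [mem_union] at this; tauto
  · have := Finsupp.support_add h
    rw [mem_union] at this; tauto

/-- Scaling creates no new poles. -/
theorem poles_smul_subset (a : ℚ) (v : PF) : (v.smul a).poles ⊆ v.poles := by
  unfold poles PF.smul
  exact union_subset_union Finsupp.support_smul Finsupp.support_smul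

/-- The zero data. -/
def zero : PF := ⟨0, 0, 0⟩

/-- The zero data evaluate to `0`. -/
theorem eval_zero' (t : ℚ) : zero.eval t = 0 := by simp [PF.eval, zero]

/-- The zero data have no poles. -/
theorem poles_zero : zero.poles = ∅ := by simp [poles, zero]

/-- Horner multiplication by a polynomial given by its coefficient list `[x₀, x₁, …]`:
data of `(x₀ + x₁ t + x₂ t² + …)·v(t)`, built from `smul`, `add` and `mulLin 0` (multiplication by `t`). -/
def mulCoeffs : List ℚ → PF → PF
  | [], _ => zero
  | x :: xs, v => (v.smul x).add ((mulCoeffs xs v).mulLin 0)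

/-- `mulCoeffs` creates no new poles. -/
theorem poles_mulCoeffs_subset (xs : List ℚ) (v : PF) : (mulCoeffs xs v).poles ⊆ v.poles := by
  induction xs with
  | nil => simp [mulCoeffs, poles_zero]
  | cons x xs ih =>
    refine (poles_add_subset _ _).trans (union_subset (poles_smul_subset x v) ?_)
    exact (poles_mulLin_subset 0 _).trans ih

/-- Evaluation of a coefficient list as a polynomial (Horner). -/
def evalCoeffs : List ℚ → ℚ → ℚ
  | [], _ => 0
  | x :: xs, t => x + t * evalCoeffs xs t

/-- **Evaluation of `mulCoeffs`**: off the poles, `(mulCoeffs xs v)(t) = x(t)·v(t)` with `x` the polynomial with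
coefficient list `xs`. -/
theorem eval_mulCoeffs (xs : List ℚ) (v : PF) (t : ℚ) (ht : ∀ k ∈ v.poles, t + k ≠ 0) :
    (mulCoeffs xs v).eval t = evalCoeffs xs t * v.eval t := by
  induction xs with
  | nil => simp [mulCoeffs, evalCoeffs, eval_zero']
  | cons x xs ih =>
    simp only [mulCoeffs, evalCoeffs]
    rw [PF.eval_add, PF.eval_smul, eval_mulLin 0 _ t (fun k hk => ht k (poles_mulCoeffs_subset xs v hk)), ih]
    push_cast
    ring

end PF


end Summit.KontsevichZagierPeriods.Zeta5Search.FormalBarnes
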